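import Literature.Probability.Percolation.GladkovThreeClusterDichotomyProofs
import HarnessLib

/-!
# The second-moment row `(M2)` implies the square-root law `(SQ)` — Cauchy–Schwarz along the patterns of the port's cluster

Support file for crux `stmt-CriticalPhenomena-4575` (`NoHeavyLowerTail`), lead seat `prim-nh-lead-4575` gen 128
(`--supports stmt-CriticalPhenomena-4575`; memo `run/shared/lean/prim/prim-sahi/FROM-prim-nh-lead-4575-g128-V4-FIBRE-SQ.md` §1(c);
the finitary formulation below is the literature seat's, `prim-sahi-lit` gen 62, LITERATURE §78.4, scratch `ScratchM2SQ.lean`).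
No definitions, no sorries, standard axioms.

Setting: a finite vertex type `V`, pair weights `p` (resp. `w`), a port `c`, a terminal set (here written out for
`T = {s,a,b}`), and an ARBITRARY event `F` of configurations.  Write `c∤T` for "no terminal lies in the open cluster `cl K c`",
`Q = P(F ∩ c∤T)`, `C = P(c∤T)` and
`M₂ = Σ_π wt(π) · P_{unrevealed}(F-section at π)²`, the sum over the patterns `π` of the exploration of the cluster of `c`
(phase `K ↦ touch (cl K c)`, `Gladkov.selfDetermined_touch_cl`) — i.e. `M₂ = E[1_{c∤T} · P(F | C_c)²]` in probabilistic words.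
* `sq_le_C_mul_secondMoment` — **`Q² ≤ C · M₂`**: verbatim instance of the tree's `DecisionTree.sq_PrW_le_PrW_mul_sum_pats`
  [cite: Gladkov2024, Thm 5.2] (Cauchy–Schwarz along the patterns of a decided phase) with `A = {c∤T}` (local for that phase) and `B = A ∩ F`
  — no monotonicity of `F` is needed;
* `sqrtLaw_of_secondMoment` — **`(M2) ⟹ (SQ)`**: `M₂ ≤ P(F)²` implies `P(F ∩ c∤T)² ≤ P(F)² · P(c∤T)`;
* `sqrtLaw_event_of_secondMoment` — the same at the event level for `μ = prodBernoulli w`, `F = (s↔a) ∩ (s↔b)ᶜ`, `T = {s,a,b}`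
  (bridge `DecisionTree.prodBernoulli_real_eq_PrW_univ`), in exactly the shape of the hypothesis of
  `SuperTerminalQuarticOfSqrtLaw.superTerminalQuartic_of_sqrtLaw` (so `(M2) ⟹ (SQ) ⟹ V4 ⟹ P3_{1/2}` is available to the kernel).
`(M2)` itself (numerically unrefuted, lead gen 128) is OPEN; nothing here claims it.
-/

noncomputable section

namespace Summit.CriticalPhenomena.PercolationContinuityZ3.Theorems.SuperTerminalSqrtLawOfSecondMoment

open Finset MeasureTheory
open Literature.Probability.Percolation Literature.Probability.Percolation.DecisionTree
  Literature.Probability.Percolation.Gladkov Literature.Probability.LatticeModels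
open scoped Classical

section Patterns

variable {V : Type*} [Fintype V] [DecidableEq V]

/-- The event `{c ∤ {s,a,b}}` (no terminal in the open cluster of the port) is local for the exploration phase of the
cluster of `c`. [this work] -/
theorem localOn_portIso (c s a b : V) :
    LocalOn (fun K : Finset (Sym2 V) => touch (cl K c))
      ({K : Finset (Sym2 V) | s ∉ cl K c ∧ a ∉ cl K c ∧ b ∉ cl K c}) := by
  intro K K' h hK
  have hcl : cl K' c = cl K c := cl_eq_of_agree h
  simp only [Set.mem_setOf_eq, hcl] at hK ⊢
  exact hK

/-- **`Q² ≤ C · M₂`** (Cauchy–Schwarz along the patterns of the port's cluster): for every event `A` that is local for the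
exploration phase of the cluster of `c` (e.g. `{c ∤ T}`, `localOn_portIso`) and every event `F`,
`P(A ∩ F)² ≤ P(A) · Σ_π wt(π)·P((A ∩ F)-section at π)²`.  Instance of `DecisionTree.sq_PrW_le_PrW_mul_sum_pats`.
[cite: Gladkov2024, Thm 5.2] -/
theorem sq_le_C_mul_secondMoment (D : Finset (Sym2 V)) {p : Sym2 V → ℝ} (hp0 : ∀ i, 0 ≤ p i)
    (hp1 : ∀ i, p i ≤ 1) (c : V) {A : Set (Finset (Sym2 V))}
    (hA : LocalOn (fun K : Finset (Sym2 V) => touch (cl K c)) A) (F : Set (Finset (Sym2 V))) :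
    PrW D p (A ∩ F) ^ 2 ≤
      PrW D p A *
        ∑ π ∈ pats D (fun K => touch (cl K c)),
          wtW (D.filter (· ∈ touch (cl π c))) p π * PrW (D \ touch (cl π c)) p {L | π ∪ L ∈ A ∩ F} ^ 2 :=
  sq_PrW_le_PrW_mul_sum_pats D hp0 hp1 (selfDetermined_touch_cl c) hA Set.inter_subset_left

/-- **`(M2) ⟹ (SQ)`** in the finitary (pattern) form: if the second moment of the `F`-section along the port's cluster,
restricted to a phase-local event `A` (= `{c∤T}`), is at most `P(F)²`, then `P(A ∩ F)² ≤ P(F)² · P(A)`. [this work] -/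
theorem sqrtLaw_of_secondMoment (D : Finset (Sym2 V)) {p : Sym2 V → ℝ} (hp0 : ∀ i, 0 ≤ p i)
    (hp1 : ∀ i, p i ≤ 1) (c : V) {A : Set (Finset (Sym2 V))}
    (hA : LocalOn (fun K : Finset (Sym2 V) => touch (cl K c)) A) (F : Set (Finset (Sym2 V)))
    (hM2 : ∑ π ∈ pats D (fun K => touch (cl K c)),
          wtW (D.filter (· ∈ touch (cl π c))) p π * PrW (D \ touch (cl π c)) p {L | π ∪ L ∈ A ∩ F} ^ 2 ≤
        PrW D p F ^ 2) :
    PrW D p (A ∩ F) ^ 2 ≤ PrW D p F ^ 2 * PrW D p A := by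
  have h1 := sq_le_C_mul_secondMoment D hp0 hp1 c hA F
  have hC : 0 ≤ PrW D p A := PrW_nonneg D hp0 hp1 _
  have h2 := mul_le_mul_of_nonneg_left hM2 hC
  linarith [h1, h2, mul_comm (PrW D p F ^ 2) (PrW D p A)]

end Patterns

/-- **`(M2) ⟹ (SQ)` at the event level** for `μ = prodBernoulli w`, `F = (s↔a) ∩ (s↔b)ᶜ`, `c∤T = (c↔s)ᶜ ∩ (c↔a)ᶜ ∩ (c↔b)ᶜ`:
if `M₂ ≤ P(F)²` (hypothesis in pattern form, `D = univ`), then `μ(F ∩ c∤T)² ≤ μ(F)²·μ(c∤T)` — the hypothesis `(SQ)` of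
`SuperTerminalQuarticOfSqrtLaw.superTerminalQuartic_of_sqrtLaw`.  (Stated, like the tree's `prodBernoulli` corollaries, with the classical
instances only, outside the `[DecidableEq V]` section.) [this work] -/
theorem sqrtLaw_event_of_secondMoment {V : Type*} [Fintype V] (w : Sym2 V → unitInterval) (s a b c : V)
    (hM2 : ∑ π ∈ pats (Finset.univ : Finset (Sym2 V)) (fun K => touch (cl K c)),
          wtW ((Finset.univ : Finset (Sym2 V)).filter (· ∈ touch (cl π c))) (fun e => (w e : ℝ)) π *
            PrW (Finset.univ \ touch (cl π c)) (fun e => (w e : ℝ))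
              {L | π ∪ L ∈ ({K : Finset (Sym2 V) | s ∉ cl K c ∧ a ∉ cl K c ∧ b ∉ cl K c} ∩
                {K : Finset (Sym2 V) | a ∈ cl K s ∧ b ∉ cl K s})} ^ 2 ≤
        PrW Finset.univ (fun e => (w e : ℝ)) {K : Finset (Sym2 V) | a ∈ cl K s ∧ b ∉ cl K s} ^ 2) :
    (prodBernoulli w).real (openConn s a ∩ (openConn s b)ᶜ ∩
        ((openConn c s)ᶜ ∩ (openConn c a)ᶜ ∩ (openConn c b)ᶜ) : Set (BondConfig V)) ^ 2 ≤
      (prodBernoulli w).real (openConn s a ∩ (openConn s b)ᶜ : Set (BondConfig V)) ^ 2 *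
      (prodBernoulli w).real ((openConn c s)ᶜ ∩ (openConn c a)ᶜ ∩ (openConn c b)ᶜ : Set (BondConfig V)) := by
  classical
  have hp0 : ∀ i, 0 ≤ (fun e => (w e : ℝ)) i := fun i => (w i).2.1
  have hp1 : ∀ i, (fun e => (w e : ℝ)) i ≤ 1 := fun i => (w i).2.2
  have hcl : ∀ (S : Finset (Sym2 V)) (u v : V), (↑S : Set (Sym2 V)) ∈ openConn u v ↔ v ∈ cl S u :=
    fun S u v => by rw [mem_cl]; rfl
  have eF : (prodBernoulli w).real (openConn s a ∩ (openConn s b)ᶜ : Set (BondConfig V)) =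
      PrW Finset.univ (fun e => (w e : ℝ)) {K : Finset (Sym2 V) | a ∈ cl K s ∧ b ∉ cl K s} :=
    prodBernoulli_real_eq_PrW_univ w fun S => by
      simp only [Set.mem_setOf_eq, Set.mem_inter_iff, Set.mem_compl_iff, hcl]
  have eI : (prodBernoulli w).real ((openConn c s)ᶜ ∩ (openConn c a)ᶜ ∩ (openConn c b)ᶜ : Set (BondConfig V)) =
      PrW Finset.univ (fun e => (w e : ℝ)) {K : Finset (Sym2 V) | s ∉ cl K c ∧ a ∉ cl K c ∧ b ∉ cl K c} :=
    prodBernoulli_real_eq_PrW_univ w fun S => by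
      simp only [Set.mem_setOf_eq, Set.mem_inter_iff, Set.mem_compl_iff, hcl, and_assoc]
  have eQ : (prodBernoulli w).real (openConn s a ∩ (openConn s b)ᶜ ∩
        ((openConn c s)ᶜ ∩ (openConn c a)ᶜ ∩ (openConn c b)ᶜ) : Set (BondConfig V)) =
      PrW Finset.univ (fun e => (w e : ℝ)) ({K : Finset (Sym2 V) | s ∉ cl K c ∧ a ∉ cl K c ∧ b ∉ cl K c} ∩
        {K : Finset (Sym2 V) | a ∈ cl K s ∧ b ∉ cl K s}) :=
    prodBernoulli_real_eq_PrW_univ w fun S => by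
      simp only [Set.mem_setOf_eq, Set.mem_inter_iff, Set.mem_compl_iff, hcl]
      tauto
  rw [eF, eI, eQ]
  exact sqrtLaw_of_secondMoment Finset.univ hp0 hp1 c (localOn_portIso c s a b) _ hM2

end Summit.CriticalPhenomena.PercolationContinuityZ3.Theorems.SuperTerminalSqrtLawOfSecondMoment

end
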